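import Literature.InformationTheory.Entropy.MapEntropy
import Mathlib.Probability.Distributions.Uniform
import HarnessLib

/-!
# Perfect randomized encodings (Ishai–Kushilevitz / Applebaum–Ishai–Kushilevitz), combinatorial form

A *randomized encoding* of a function `f` is a function `f̂(x, r)` of the input `x` and fresh
randomness `r` whose output distribution on a fixed `x` and uniform `r` determines `f x` and reveals
nothing else about `x` [Applebaum–Ishai–Kushilevitz 2006, Def. 4.1].  The PERFECT variant
[AIK 2006, Def. 4.6: perfectly correct, perfectly private, balanced, stretch-preserving] is used by
Dvir–Gutfreund–Rothblum–Vadhan in the purely combinatorial form of [DGRV 2010, Def. 4.1], which is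
what this file formalizes, for arbitrary types (print: bit strings) and a finite randomness space
`ρ` (print: `{0,1}^m`) carrying the uniform distribution:

`IsPerfectRandomizedEncoding f enc b` — `enc : α → ρ → γ` is a perfect randomized encoding of
`f : α → β` with BLOWUP `b`:
* *input independent*: `f x = f x'` ⟹ `enc x (U_ρ)` and `enc x' (U_ρ)` are identically distributed
  (stated by fibre cardinalities: every output value has as many preimages under `enc x` as under
  `enc x'`) — AIK's perfect privacy;
* *output disjoint*: `f x ≠ f x'` ⟹ the supports of `enc x (U_ρ)`, `enc x' (U_ρ)` are disjoint
  (equivalently a decoder exists, `exists_decoder`) — AIK's perfect correctness;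
* *uniform*: `enc x (U_ρ)` is uniform on its support (all nonempty fibres of `enc x` have the same size);
* *balanced*: every support `enc x (ρ)` has exactly `b` elements.

## Main statements (all proved)

* `card_fiber_mul_blowup`: every nonempty fibre of `enc x` has size `|ρ| / b` (so `b ∣ |ρ|`);
  `image_eq` / `disjoint_image`: the supports `S_y` depend only on `y = f x` and are pairwise
  disjoint [DGRV, §4.1]; `card_image_uncurry` — **Claim 4.2** `|Supp f̂| = b · |Supp f|`;
  `card_fiber_uncurry_mul_blowup` — **Claim 4.3** `Pr[f̂(U) = z] = Pr[f(U) = y_z] / b` in counting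
  form; `mapEntropy_uncurry_eq` — **Claim 4.4** (Shannon case)
  `H(f̂(U_α × U_ρ)) = H(f(U_α)) + log₂ b`, the identity behind `ED_BP ≤ PED_{F₂,3}` [DGRV, Thm 4.6]
  and [Allender–Gray–Mutreja–Tirumala–Wang 2025, Lemma 10].
* `of_injective` — AIK's "combinatorial view of perfect encoding" [AIK 2006, p. 9, and Lemma 4.12
  (unique randomness)]: if every `enc x` is injective in the randomness, outputs decode, and the
  RANGE of `enc x` depends only on `f x`, then `enc` is a perfect randomized encoding with blowup
  `|ρ|` (the stretch-preserving case `b = 2^m`); conversely `injective_of_blowup_eq`.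
* closure: `prod` (concatenation with independent randomness [AIK 2006, Lemma 4.9], blowups
  multiply), `pad` (padding the output with fresh uniform randomness multiplies the blowup by its
  size — the balancing step in the proof of [DGRV, Thm 4.6]), `of_fiber_iff` (only the partition
  `{f = y}` of the inputs matters), `self` (`f` encodes itself with `b = 1`), `randomness`
  (`r ↦ r` encodes a constant function with `b = |ρ|`);
* `map_uniformOfFintype_eq` — the `PMF` phrasing of input independence (equal push-forwards of the
  uniform distribution), for use with the `PMF`-based files of this directory.

## Design choices / deviations from print

* Print fixes bit strings `{0,1}^n → {0,1}^ℓ`, `{0,1}^n × {0,1}^m → {0,1}^s`; here `α, β, γ` are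
  arbitrary and only the randomness space `ρ` must be a `Fintype` (it carries the uniform
  distribution).  "Identically distributed" / "uniform over the support" are stated through the
  fibres `fiber univ (enc x) z = {r | enc x r = z}` of `Literature.InformationTheory.Entropy` (the
  vocabulary of `mapEntropy`, hence of `PolyMapF2.entropy` and the promise problems `PEA`/`PED`).
* AIK's Def. 4.6 speaks of a decoder, a perfectly private BALANCED simulator `S` (`S(U_ℓ) ≡ U_s`)
  and stretch preservation `s = ℓ + m`; by AIK's own "combinatorial view" (p. 9) and Lemma 4.12
  (unique randomness) such an encoding has, for every `x`, `f̂(x, ·)` injective and uniform on a set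
  `S_{f(x)}` of size exactly `2^m` depending only on `f(x)`, the sets being pairwise disjoint — i.e.
  it IS a perfect randomized encoding with blowup `b = 2^m` in the present (DGRV) sense, which is the
  form DGRV and the tree's consumers use (`of_injective` builds it from exactly these three facts).
  We do not formalize simulators/decoders as algorithms, nor the efficiency clauses of AIK's uniform
  Def. 4.3 (DGRV: "[IK, AIK] use different, more cryptographic, terminology").
* NOT here: the degree-3 encoding of branching programs [IK 2002, §3; AIK 2006, Facts 4.13–4.14,
  Lemma 4.15; DGRV Thm 4.5] — the tree has the Ishai–Kushilevitz matrix randomization for the path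
  program of an iterated product and the resulting degree-3 perfect encoding `RandPoly.encodeMap` of
  any sparse polynomial map over `F₂` (`Literature/Computability/Complexity/RandomizingPolynomials*.lean`,
  `DegreeThreeEncoding*.lean`, valuation-level notion `RandPoly.PerfExt`, and `PEA_d ≤ₚ PEA_3` in
  `PEADegreeReduction.lean`); the bridge `RandPoly.PerfExt → IsPerfectRandomizedEncoding (b = 2^m)`
  is in the companion file `PerfectRandomizedEncodingPolyMap.lean`.  Statistical / computational
  encodings (AIK Def. 4.5) and the composition lemma (AIK Lemma 4.11) are not here.

## References

* B. Applebaum, Y. Ishai, E. Kushilevitz, *Cryptography in NC⁰*, SIAM J. Comput. 36 (2006)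
  845–888: Def. 4.1, Def. 4.4, Def. 4.6, "A combinatorial view of perfect encoding" (p. 9),
  Lemma 4.9, Lemma 4.12.  bib `ApplebaumIshaiKushilevitz2006`.
* Z. Dvir, D. Gutfreund, G. N. Rothblum, S. Vadhan, *On approximating the entropy of polynomial
  mappings*, ECCC TR10-160 (2010) / ICS 2011: §4.1 Def. 4.1, Claims 4.2–4.4 (PDF pp. 8–9),
  Thm 4.5–4.6.  bib `DvirGutfreundRothblumVadhan2010`.
* Y. Ishai, E. Kushilevitz, ICALP 2002 (perfect randomizing polynomials).  bib `IshaiKushilevitz2002`.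
* E. Allender, J. Gray, S. Mutreja, H. Tirumala, P. Wang, ACM ToCT 17 (2025), Lemma 10.
  bib `AllenderGrayMutrejaTirumalaWang2025`.
-/

namespace Literature.Computability.Cryptography

open Finset Literature.InformationTheory.Entropy

variable {α β γ ρ : Type*}

/-! ### Fibres over the whole randomness space -/

section Fiber

variable [Fintype ρ] [DecidableEq γ]

/-- An injective map has singleton fibres through its values. [folklore] -/
theorem card_fiber_univ_of_injective {g : ρ → γ} (hg : Function.Injective g) (r : ρ) :
    (fiber univ g (g r)).card = 1 := by
  rw [Finset.card_eq_one]
  refine ⟨r, Finset.ext fun s => ?_⟩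
  simp only [mem_fiber, Finset.mem_univ, true_and, Finset.mem_singleton]
  exact hg.eq_iff

/-- A value outside the range has an empty fibre. [folklore] -/
theorem card_fiber_univ_eq_zero {g : ρ → γ} {z : γ} (hz : ¬ ∃ r, g r = z) :
    (fiber univ g z).card = 0 := by
  by_contra hne
  obtain ⟨s, hs⟩ := Finset.card_pos.1 (Nat.pos_of_ne_zero hne)
  exact hz ⟨s, (mem_fiber.1 hs).2⟩

/-- A value is attained iff its fibre is nonempty. [folklore] -/
theorem mem_image_univ_iff_card_fiber_pos (g : ρ → γ) (z : γ) :
    z ∈ univ.image g ↔ 0 < (fiber univ g z).card := by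
  rw [Finset.card_pos, Finset.mem_image]
  constructor
  · rintro ⟨r, -, rfl⟩
    exact ⟨r, self_mem_fiber g (mem_univ r)⟩
  · rintro ⟨r, hr⟩
    exact ⟨r, mem_univ r, (mem_fiber.1 hr).2⟩

end Fiber

/-! ### The notion -/

/-- **Perfect randomized encoding with blowup `b`** (combinatorial form).  `enc : α → ρ → γ` is a
perfect randomized encoding of `f : α → β` with blowup `b` if, for the uniform distribution on the
finite randomness space `ρ`: (input independent) `f x = f x'` implies `enc x (U_ρ) ≡ enc x' (U_ρ)`,
i.e. every `z` has equally many preimages under `enc x` and `enc x'`; (output disjoint) outputs of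
inputs with different `f`-values never coincide; (uniform) `enc x (U_ρ)` is uniform on its support,
i.e. all nonempty fibres of `enc x` have the same size; (balanced) every support has exactly `b`
elements.  Print: `f : {0,1}ⁿ → {0,1}^ℓ`, `f̂ : {0,1}ⁿ × {0,1}^m → {0,1}^s`; AIK's perfect encodings
(Def. 4.6: perfectly correct and private, balanced, stretch-preserving) are the case `b = 2^m`
(`of_injective`, `injective_of_blowup_eq`).
[DGRV 2010, Def. 4.1; AIK 2006, Def. 4.1/4.4/4.6] [cite: DvirGutfreundRothblumVadhan2010, Def. 4.1] -/
structure IsPerfectRandomizedEncoding [Fintype ρ] [DecidableEq γ] (f : α → β) (enc : α → ρ → γ)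
    (b : ℕ) : Prop where
  /-- Input independence (perfect privacy): inputs with the same `f`-value have identically
  distributed encodings — equal fibre counts for every output value. -/
  input_independent : ∀ x x', f x = f x' → ∀ z, (fiber univ (enc x) z).card = (fiber univ (enc x') z).card
  /-- Output disjointness (perfect correctness): an output value determines `f x`. -/
  output_disjoint : ∀ x x' r r', enc x r = enc x' r' → f x = f x'
  /-- Uniformity: all nonempty fibres of `enc x` have the same size. -/
  uniform : ∀ x r r', (fiber univ (enc x) (enc x r)).card = (fiber univ (enc x) (enc x r')).card
  /-- Balance: every support has exactly `b` elements. -/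
  balanced : ∀ x, (univ.image (enc x)).card = b

namespace IsPerfectRandomizedEncoding

variable [Fintype ρ] [DecidableEq γ] {f : α → β} {enc : α → ρ → γ} {b : ℕ}

/-! ### Supports and fibres [DGRV 2010, §4.1] -/

/-- Inputs with the same `f`-value have the same SET of encodings (`S_{f x}` is well defined).
[cite: DvirGutfreundRothblumVadhan2010, §4.1] -/
theorem mem_image_iff (h : IsPerfectRandomizedEncoding f enc b) {x x' : α} (hxx' : f x = f x')
    (z : γ) : z ∈ univ.image (enc x) ↔ z ∈ univ.image (enc x') := by
  rw [mem_image_univ_iff_card_fiber_pos, mem_image_univ_iff_card_fiber_pos,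
    h.input_independent x x' hxx' z]

/-- The support of `enc x (U_ρ)` depends only on `f x`. [cite: DvirGutfreundRothblumVadhan2010, §4.1] -/
theorem image_eq (h : IsPerfectRandomizedEncoding f enc b) {x x' : α} (hxx' : f x = f x') :
    univ.image (enc x) = univ.image (enc x') :=
  Finset.ext fun z => h.mem_image_iff hxx' z

/-- Range form of input independence: every encoding of `x` is an encoding of every `x'` with
`f x' = f x`. [cite: DvirGutfreundRothblumVadhan2010, §4.1] -/
theorem exists_enc_eq (h : IsPerfectRandomizedEncoding f enc b) {x x' : α} (hxx' : f x = f x')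
    (r : ρ) : ∃ r', enc x' r' = enc x r := by
  have hz : enc x r ∈ univ.image (enc x') :=
    (h.mem_image_iff hxx' _).1 (Finset.mem_image.2 ⟨r, mem_univ r, rfl⟩)
  obtain ⟨r', -, hr'⟩ := Finset.mem_image.1 hz
  exact ⟨r', hr'⟩

/-- Supports of inputs with different `f`-values are disjoint. [cite: DvirGutfreundRothblumVadhan2010, Def. 4.1] -/
theorem disjoint_image (h : IsPerfectRandomizedEncoding f enc b) {x x' : α} (hxx' : f x ≠ f x') :
    Disjoint (univ.image (enc x)) (univ.image (enc x')) := by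
  rw [Finset.disjoint_left]
  intro z hz hz'
  obtain ⟨r, -, rfl⟩ := Finset.mem_image.1 hz
  obtain ⟨r', -, hr'⟩ := Finset.mem_image.1 hz'
  exact hxx' (h.output_disjoint x x' r r' hr'.symm)

/-- **A decoder exists** (AIK's perfect correctness): some `dec : γ → β` recovers `f x` from every
encoding of `x`. [cite: ApplebaumIshaiKushilevitz2006, Def. 4.1] -/
theorem exists_decoder [Nonempty β] (h : IsPerfectRandomizedEncoding f enc b) :
    ∃ dec : γ → β, ∀ x r, dec (enc x r) = f x := by
  classical
  refine ⟨fun z => if hz : ∃ p : α × ρ, enc p.1 p.2 = z then f hz.choose.1 else Classical.arbitrary β,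
    fun x r => ?_⟩
  have hz : ∃ p : α × ρ, enc p.1 p.2 = enc x r := ⟨(x, r), rfl⟩
  simp only [hz, dite_true]
  exact h.output_disjoint _ _ _ _ hz.choose_spec

/-- **Every nonempty fibre of `enc x` has size `|ρ| / b`**: uniform + balanced.
[cite: DvirGutfreundRothblumVadhan2010, §4.1] -/
theorem card_fiber_mul_blowup (h : IsPerfectRandomizedEncoding f enc b) (x : α) (r : ρ) :
    (fiber univ (enc x) (enc x r)).card * b = Fintype.card ρ := by
  calc (fiber univ (enc x) (enc x r)).card * b
      = ∑ _z ∈ univ.image (enc x), (fiber univ (enc x) (enc x r)).card := by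
        rw [Finset.sum_const, smul_eq_mul, h.balanced x, mul_comm]
    _ = ∑ z ∈ univ.image (enc x), (fiber univ (enc x) z).card := by
        refine Finset.sum_congr rfl fun z hz => ?_
        obtain ⟨r', -, rfl⟩ := Finset.mem_image.1 hz
        exact h.uniform x r r'
    _ = Fintype.card ρ := by
        rw [← Finset.card_univ, Finset.card_eq_sum_card_image (enc x) univ]
        rfl

/-- The blowup is positive (as soon as there is an input and a random string). [folklore] -/
theorem blowup_pos [Nonempty ρ] (h : IsPerfectRandomizedEncoding f enc b) (x : α) : 0 < b := by
  rw [← h.balanced x, Finset.card_pos]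
  exact ⟨enc x (Classical.arbitrary ρ), Finset.mem_image.2 ⟨_, mem_univ _, rfl⟩⟩

/-- The blowup divides the size of the randomness space (for `ρ = {0,1}^m`: `b` is a power of `2`,
as in DGRV Thm 4.5). [folklore] -/
theorem blowup_dvd_card (h : IsPerfectRandomizedEncoding f enc b) (x : α) (r : ρ) :
    b ∣ Fintype.card ρ :=
  ⟨(fiber univ (enc x) (enc x r)).card, by rw [mul_comm]; exact (h.card_fiber_mul_blowup x r).symm⟩

/-- The blowup is at most the size of the randomness space. [folklore] -/
theorem blowup_le_card (h : IsPerfectRandomizedEncoding f enc b) (x : α) : b ≤ Fintype.card ρ := by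
  rw [← h.balanced x, ← Finset.card_univ]
  exact Finset.card_image_le

/-! ### AIK's combinatorial view: the injective (stretch-preserving) case -/

/-- **Perfect encodings from unique randomness** (AIK's combinatorial view of Def. 4.6): if each
`enc x` is injective in the randomness, outputs decode `f`, and the range of `enc x` depends only on
`f x`, then `enc` is a perfect randomized encoding of `f` with blowup `|ρ|`.
[cite: ApplebaumIshaiKushilevitz2006, §4.1 p. 9 and Lemma 4.12] -/
theorem of_injective (hinj : ∀ x, Function.Injective (enc x))
    (hdec : ∀ x x' r r', enc x r = enc x' r' → f x = f x')
    (hrange : ∀ x x', f x = f x' → ∀ r, ∃ r', enc x' r' = enc x r) :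
    IsPerfectRandomizedEncoding f enc (Fintype.card ρ) where
  input_independent x x' hxx' z := by
    by_cases hz : ∃ r, enc x r = z
    · obtain ⟨r, rfl⟩ := hz
      obtain ⟨r', hr'⟩ := hrange x x' hxx' r
      rw [card_fiber_univ_of_injective (hinj x) r, ← hr', card_fiber_univ_of_injective (hinj x') r']
    · have hz' : ¬ ∃ r', enc x' r' = z := by
        rintro ⟨r', rfl⟩
        obtain ⟨r, hr⟩ := hrange x' x hxx'.symm r'
        exact hz ⟨r, hr⟩
      rw [card_fiber_univ_eq_zero hz, card_fiber_univ_eq_zero hz']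
  output_disjoint := hdec
  uniform x r r' := by
    rw [card_fiber_univ_of_injective (hinj x), card_fiber_univ_of_injective (hinj x)]
  balanced x := by
    rw [Finset.card_image_of_injective _ (hinj x), Finset.card_univ]

/-- **Unique randomness**: with blowup `|ρ|` every `enc x` is injective in the randomness.
[cite: ApplebaumIshaiKushilevitz2006, Lemma 4.12] -/
theorem injective_of_blowup_eq (h : IsPerfectRandomizedEncoding f enc (Fintype.card ρ)) (x : α) :
    Function.Injective (enc x) := by
  intro r r' hrr'
  have hρ : 0 < Fintype.card ρ := Fintype.card_pos_iff.2 ⟨r⟩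
  have hc : (fiber univ (enc x) (enc x r)).card * Fintype.card ρ = 1 * Fintype.card ρ := by
    rw [h.card_fiber_mul_blowup x r, one_mul]
  obtain ⟨s, hs⟩ := Finset.card_eq_one.1 (Nat.eq_of_mul_eq_mul_right hρ hc)
  have hr : r ∈ fiber univ (enc x) (enc x r) := self_mem_fiber _ (mem_univ r)
  have hr' : r' ∈ fiber univ (enc x) (enc x r) := mem_fiber.2 ⟨mem_univ _, hrr'.symm⟩
  rw [hs, Finset.mem_singleton] at hr hr'
  exact hr.trans hr'.symm

/-! ### Changing the target; trivial encodings -/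

/-- Only the partition of the inputs into level sets of the target matters. [folklore] -/
theorem of_fiber_iff {β' : Type*} {g : α → β'} (h : IsPerfectRandomizedEncoding f enc b)
    (hg : ∀ x x', g x = g x' ↔ f x = f x') : IsPerfectRandomizedEncoding g enc b where
  input_independent x x' hxx' := h.input_independent x x' ((hg x x').1 hxx')
  output_disjoint x x' r r' hr := (hg x x').2 (h.output_disjoint x x' r r' hr)
  uniform := h.uniform
  balanced := h.balanced

/-- `f` is a perfect randomized encoding of itself (no randomness, blowup `1`). [folklore] -/
theorem self [DecidableEq β] (f : α → β) :
    IsPerfectRandomizedEncoding f (fun x (_ : Unit) => f x) 1 := by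
  have h := of_injective (f := f) (enc := fun x (_ : Unit) => f x)
    (fun x r r' _ => Subsingleton.elim r r') (fun x x' _ _ h => h) (fun x x' h _ => ⟨(), h.symm⟩)
  rwa [Fintype.card_unit] at h

/-- The randomness itself is a perfect randomized encoding of any constant function, with blowup
`|ρ|` (uniform padding bits). [cite: DvirGutfreundRothblumVadhan2010, Thm 4.6 (proof)] -/
theorem randomness [DecidableEq ρ] (α : Type*) :
    IsPerfectRandomizedEncoding (fun _ : α => PUnit.unit.{1}) (fun (_ : α) (r : ρ) => r) (Fintype.card ρ) :=
  of_injective (fun _ _ _ h => h) (fun _ _ _ _ _ => rfl) (fun _ _ _ r => ⟨r, rfl⟩)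

/-! ### Concatenation with independent randomness [AIK 2006, Lemma 4.9] -/

section Prod

variable {β₁ β₂ γ₁ γ₂ ρ₁ ρ₂ : Type*} [Fintype ρ₁] [Fintype ρ₂] [DecidableEq γ₁] [DecidableEq γ₂]

/-- Fibres of a map acting coordinatewise on a product. [folklore] -/
theorem fiber_univ_prodMk (g₁ : ρ₁ → γ₁) (g₂ : ρ₂ → γ₂) (z₁ : γ₁) (z₂ : γ₂) :
    fiber univ (fun r : ρ₁ × ρ₂ => (g₁ r.1, g₂ r.2)) (z₁, z₂) = fiber univ g₁ z₁ ×ˢ fiber univ g₂ z₂ := by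
  ext ⟨r₁, r₂⟩
  simp [mem_fiber]

/-- Image of a map acting coordinatewise on a product. [folklore] -/
theorem image_univ_prodMk (g₁ : ρ₁ → γ₁) (g₂ : ρ₂ → γ₂) :
    (univ : Finset (ρ₁ × ρ₂)).image (fun r => (g₁ r.1, g₂ r.2)) = univ.image g₁ ×ˢ univ.image g₂ := by
  ext ⟨z₁, z₂⟩
  simp [Finset.mem_image, Prod.ext_iff]

/-- **Concatenation lemma**: encoding `f₁` and `f₂` with independent randomness is a perfect
randomized encoding of `x ↦ (f₁ x, f₂ x)`; blowups multiply. [cite: ApplebaumIshaiKushilevitz2006, Lemma 4.9] -/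
theorem prod {f₁ : α → β₁} {f₂ : α → β₂} {enc₁ : α → ρ₁ → γ₁} {enc₂ : α → ρ₂ → γ₂} {b₁ b₂ : ℕ}
    (h₁ : IsPerfectRandomizedEncoding f₁ enc₁ b₁) (h₂ : IsPerfectRandomizedEncoding f₂ enc₂ b₂) :
    IsPerfectRandomizedEncoding (fun x => (f₁ x, f₂ x))
      (fun x (r : ρ₁ × ρ₂) => (enc₁ x r.1, enc₂ x r.2)) (b₁ * b₂) where
  input_independent x x' hxx' z := by
    obtain ⟨z₁, z₂⟩ := z
    simp only [Prod.mk.injEq] at hxx'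
    rw [fiber_univ_prodMk (enc₁ x) (enc₂ x), fiber_univ_prodMk (enc₁ x') (enc₂ x'),
      Finset.card_product, Finset.card_product, h₁.input_independent x x' hxx'.1 z₁,
      h₂.input_independent x x' hxx'.2 z₂]
  output_disjoint x x' r r' hr := by
    simp only [Prod.mk.injEq] at hr
    exact Prod.ext (h₁.output_disjoint x x' _ _ hr.1) (h₂.output_disjoint x x' _ _ hr.2)
  uniform x r r' := by
    rw [fiber_univ_prodMk (enc₁ x) (enc₂ x), fiber_univ_prodMk (enc₁ x) (enc₂ x),
      Finset.card_product, Finset.card_product, h₁.uniform x r.1 r'.1, h₂.uniform x r.2 r'.2]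
  balanced x := by
    rw [image_univ_prodMk (enc₁ x) (enc₂ x), Finset.card_product, h₁.balanced x, h₂.balanced x]

/-- **Padding with fresh uniform randomness** multiplies the blowup by the size of the pad (used to
equalize blowups). [cite: DvirGutfreundRothblumVadhan2010, Thm 4.6 (proof)] -/
theorem pad {κ : Type*} [Fintype κ] [DecidableEq κ] (h : IsPerfectRandomizedEncoding f enc b) :
    IsPerfectRandomizedEncoding f (fun x (r : ρ × κ) => (enc x r.1, r.2)) (b * Fintype.card κ) :=
  (h.prod (randomness (ρ := κ) α)).of_fiber_iff fun x x' => by simp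

end Prod

/-! ### Counting over inputs and randomness together [DGRV 2010, Claims 4.2–4.4] -/

section Joint

variable [Fintype α] [DecidableEq β]

/-- **Claim 4.2**: `|Supp f̂(U)| = b · |Supp f(U)|` — the supports `S_y`, `y ∈ f(α)`, have `b`
elements each and tile the support of `f̂`. [cite: DvirGutfreundRothblumVadhan2010, Claim 4.2] -/
theorem card_image_uncurry (h : IsPerfectRandomizedEncoding f enc b) :
    ((univ : Finset (α × ρ)).image (Function.uncurry enc)).card = b * (univ.image f).card := by
  classical
  -- the tile over `y`: the encodings of the inputs in the level set of `y`
  set T : β → Finset γ := fun y => (fiber univ f y).biUnion fun x => univ.image (enc x) with hT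
  have hTx : ∀ x₀ : α, T (f x₀) = univ.image (enc x₀) := by
    intro x₀
    ext z
    simp only [hT, Finset.mem_biUnion, mem_fiber, Finset.mem_univ, true_and]
    constructor
    · rintro ⟨x, hx, hz⟩
      exact (h.mem_image_iff hx z).1 hz
    · intro hz
      exact ⟨x₀, rfl, hz⟩
  have hcover : (univ : Finset (α × ρ)).image (Function.uncurry enc) = (univ.image f).biUnion T := by
    ext z
    simp only [Finset.mem_image, Finset.mem_univ, true_and, Finset.mem_biUnion, Function.uncurry,
      Prod.exists]
    constructor
    · rintro ⟨x, r, rfl⟩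
      exact ⟨f x, ⟨x, rfl⟩, by rw [hTx]; exact Finset.mem_image.2 ⟨r, mem_univ r, rfl⟩⟩
    · rintro ⟨y, ⟨x₀, rfl⟩, hz⟩
      rw [hTx] at hz
      obtain ⟨r, -, hr⟩ := Finset.mem_image.1 hz
      exact ⟨x₀, r, hr⟩
  have hdisj : ((univ.image f : Finset β) : Set β).PairwiseDisjoint T := by
    intro y hy y' hy' hne
    obtain ⟨x₀, -, rfl⟩ := Finset.mem_image.1 (Finset.mem_coe.1 hy)
    obtain ⟨x₁, -, rfl⟩ := Finset.mem_image.1 (Finset.mem_coe.1 hy')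
    show Disjoint (T (f x₀)) (T (f x₁))
    rw [hTx, hTx]
    exact h.disjoint_image hne
  rw [hcover, Finset.card_biUnion hdisj, Finset.sum_congr rfl fun y hy => ?_, Finset.sum_const,
    smul_eq_mul, mul_comm]
  obtain ⟨x₀, -, rfl⟩ := Finset.mem_image.1 hy
  rw [hTx, h.balanced]

/-- **Claim 4.3** (counting form of `Pr[f̂(U_α, U_ρ) = z] = Pr[f(U_α) = y_z] / b`): the fibre of
`(x, r) ↦ enc x r` through `(x, r)`, times `b`, is the level set of `f` through `x`, times `|ρ|`.
[cite: DvirGutfreundRothblumVadhan2010, Claim 4.3] -/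
theorem card_fiber_uncurry_mul_blowup (h : IsPerfectRandomizedEncoding f enc b) (x : α) (r : ρ) :
    (fiber univ (Function.uncurry enc) (enc x r)).card * b =
      (fiber univ f (f x)).card * Fintype.card ρ := by
  classical
  set z := enc x r with hz
  -- split the joint fibre along the first coordinate
  have h1 : (fiber univ (Function.uncurry enc) z).card = ∑ x' : α, (fiber univ (enc x') z).card := by
    rw [Finset.card_eq_sum_card_fiberwise (f := Prod.fst) (s := fiber univ (Function.uncurry enc) z)
      (t := univ) fun _ _ => Finset.mem_coe.2 (mem_univ _)]
    refine Finset.sum_congr rfl fun x' _ => ?_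
    refine Finset.card_bij (fun p _ => p.2) (fun p hp => ?_) (fun p hp q hq hpq => ?_) (fun r' hr' => ?_)
    · simp only [Finset.mem_filter, mem_fiber, Finset.mem_univ, true_and, Function.uncurry] at hp
      obtain ⟨hp, rfl⟩ := hp
      exact mem_fiber.2 ⟨mem_univ _, hp⟩
    · simp only [Finset.mem_filter] at hp hq
      exact Prod.ext (hp.2.trans hq.2.symm) hpq
    · refine ⟨(x', r'), ?_, rfl⟩
      simp only [Finset.mem_filter, mem_fiber, Finset.mem_univ, true_and, Function.uncurry, and_true]
      exact (mem_fiber.1 hr').2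
  -- each slice is the fibre of `enc x` through `z` or empty
  have h2 : ∀ x' : α, (fiber univ (enc x') z).card =
      if f x' = f x then (fiber univ (enc x) z).card else 0 := by
    intro x'
    split_ifs with hx
    · exact h.input_independent x' x hx z
    · refine card_fiber_univ_eq_zero ?_
      rintro ⟨r', hr'⟩
      exact hx (h.output_disjoint x' x r' r hr')
  have h3 : ∑ x' : α, (fiber univ (enc x') z).card = (fiber univ f (f x)).card * (fiber univ (enc x) z).card := by
    rw [Finset.sum_congr rfl fun x' _ => h2 x', Finset.sum_ite, Finset.sum_const_zero, add_zero,
      Finset.sum_const, smul_eq_mul]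
    rfl
  rw [h1, h3, mul_assoc, hz, h.card_fiber_mul_blowup x r]

/-- **Claim 4.4 (Shannon entropy of a perfect randomized encoding)**:
`H(f̂(U_α × U_ρ)) = H(f(U_α)) + log₂ b` — the encoding raises the output entropy by exactly the
logarithm of the blowup (for `b = 2^m`: by the randomness length `m`).
[cite: DvirGutfreundRothblumVadhan2010, Claim 4.4] -/
theorem mapEntropy_uncurry_eq [Nonempty α] [Nonempty ρ] (h : IsPerfectRandomizedEncoding f enc b) :
    mapEntropy univ (Function.uncurry enc) = mapEntropy univ f + Real.logb 2 b := by
  classical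
  have hb : (0 : ℝ) < b := Nat.cast_pos.2 (h.blowup_pos (Classical.arbitrary α))
  have hα : (0 : ℝ) < Fintype.card α := Nat.cast_pos.2 Fintype.card_pos
  have hρ : (0 : ℝ) < Fintype.card ρ := Nat.cast_pos.2 Fintype.card_pos
  have hterm : ∀ p : α × ρ,
      Real.logb 2 (((univ : Finset (α × ρ)).card : ℝ) /
          (fiber univ (Function.uncurry enc) (Function.uncurry enc p)).card) =
        Real.logb 2 (((univ : Finset α).card : ℝ) / (fiber univ f (f p.1)).card) + Real.logb 2 b := by
    rintro ⟨x, r⟩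
    have hF : (0 : ℝ) < (fiber univ f (f x)).card := Nat.cast_pos.2 (card_fiber_pos f (mem_univ x))
    have key : ((fiber univ (Function.uncurry enc) (enc x r)).card : ℝ) * b =
        (fiber univ f (f x)).card * Fintype.card ρ := by
      exact_mod_cast h.card_fiber_uncurry_mul_blowup x r
    have hA : ((fiber univ (Function.uncurry enc) (enc x r)).card : ℝ) =
        (fiber univ f (f x)).card * Fintype.card ρ / b := by
      rw [eq_div_iff hb.ne', key]
    simp only [Function.uncurry_apply_pair, Finset.card_univ, Fintype.card_prod, Nat.cast_mul]
    rw [hA]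
    have : (Fintype.card α : ℝ) * Fintype.card ρ / ((fiber univ f (f x)).card * Fintype.card ρ / b) =
        (Fintype.card α / (fiber univ f (f x)).card) * b := by
      field_simp
    rw [this, Real.logb_mul (div_pos hα hF).ne' hb.ne']
  unfold mapEntropy
  rw [Finset.sum_congr rfl fun p _ => hterm p, Finset.sum_add_distrib, Finset.sum_const]
  have hsum : ∑ p : α × ρ, Real.logb 2 (((univ : Finset α).card : ℝ) / (fiber univ f (f p.1)).card) =
      (Fintype.card ρ : ℝ) *
        ∑ x : α, Real.logb 2 (((univ : Finset α).card : ℝ) / (fiber univ f (f x)).card) := by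
    rw [← Finset.univ_product_univ, Finset.sum_product]
    simp only [Finset.sum_const, Finset.card_univ, nsmul_eq_mul]
    rw [Finset.mul_sum]
  rw [hsum]
  simp only [Finset.card_univ, Fintype.card_prod, Nat.cast_mul, nsmul_eq_mul]
  field_simp

end Joint

/-! ### `PMF` phrasing of input independence -/

/-- Input independence as equality of push-forward distributions: for `f x = f x'` the
distributions `enc x (U_ρ)` and `enc x' (U_ρ)` coincide. [cite: DvirGutfreundRothblumVadhan2010, Def. 4.1] -/
theorem map_uniformOfFintype_eq [Nonempty ρ] (h : IsPerfectRandomizedEncoding f enc b) {x x' : α}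
    (hxx' : f x = f x') :
    (PMF.uniformOfFintype ρ).map (enc x) = (PMF.uniformOfFintype ρ).map (enc x') := by
  classical
  have hcount : ∀ (x₀ : α) (z : γ),
      ((PMF.uniformOfFintype ρ).map (enc x₀)) z =
        (fiber univ (enc x₀) z).card * (Fintype.card ρ : ENNReal)⁻¹ := by
    intro x₀ z
    rw [PMF.map_apply, tsum_fintype]
    simp only [PMF.uniformOfFintype_apply]
    rw [Finset.sum_ite, Finset.sum_const_zero, add_zero, Finset.sum_const, nsmul_eq_mul]
    congr 2
    refine Finset.card_bij (fun r _ => r) (fun r hr => ?_) (fun _ _ _ _ h => h) (fun r hr => ⟨r, ?_, rfl⟩)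
    · exact mem_fiber.2 ⟨mem_univ _, ((Finset.mem_filter.1 hr).2).symm⟩
    · exact Finset.mem_filter.2 ⟨mem_univ _, ((mem_fiber.1 hr).2).symm⟩
  ext z
  rw [hcount, hcount, h.input_independent x x' hxx' z]

end IsPerfectRandomizedEncoding

end Literature.Computability.Cryptography
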